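import Mathlib
import Literature.Analysis.FluidPDE.ClassicalSolutionRescale
import Summits.NavierStokesRegularity.NavierStokesRegularity.Theorems.LandauTailLandauTailBlowupTypeIIFatou
import Summits.NavierStokesRegularity.NavierStokesRegularity.Theorems.LandauTailLandauTailBlowupDefectFloorEngine

/-!
# Crux `LandauTail.LandauTailBlowup` (stmt-NavierStokesRegularity-1944), line `registered`, cycle c6:
  stub `landauTail_defect_floor` — the scaled `L²`-defect floor for the blow-up rescalings

Helper file on the proof path of the crux item `stmt-NavierStokesRegularity-1944`
(`Summit.NavierStokesRegularity.NavierStokesRegularity.Theses.LandauTail.LandauTailBlowup`), lead c6: the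
registered support stub `landauTail_defect_floor` (A7). For a nonzero steady `(−1)`-homogeneous profile `(U, P)`
smooth off the origin let `c = c(U) > 0` be the constant of the engine `landauTail_defect_floor_engine`. Then for
EVERY classical unit-viscosity solution `(u, p)` on `ℝ³ × (−1, 0)` with the parabolic (Landau) tail
`√(−t) u(t, √(−t) y) → U y` (`y ≠ 0`), the Navier–Stokes blow-up rescalings `u_r = nsRescale r u`
(`u_r(τ, y) = r u(r²τ, r y)`) satisfy

  `liminf_{r → 0⁺} ∫_{s₁}^{s₂} ∫_{B_ρ} |u_r − U|² ≥ c ρ (s₂ − s₁)`   (`ρ ∈ (0,1]`, `−1 ≤ s₁ < s₂ ≤ 0`):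

they never converge to the Landau flow in `L²` of any core tube, with a defect comparable to Landau's own `L²`
mass `∫_{B_ρ}|U|² ∼ ρ` at every sub-parabolic scale. Proof: a level `b'` strictly between the `liminf` and the
floor is undershot along a sequence `r_n → 0⁺` (first countability of `𝓝[>] 0`); the rescalings `u_{r_n}` are
classical solutions on `(−1, 0)` (scaling covariance `IsClassicalNSSolutionOn.nsRescale_holds`) converging
pointwise off the axis to `U` (`landauTail_nsRescale_tendsto_profile`), so the engine bounds their `liminf` from
below by the floor — a contradiction.

References: Landau 1944; Lemarié-Rieusset 2016 (10.48); Chae 2007, proof of Thm 1.5 (blow-up rescaling).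
-/

set_option linter.dupNamespace false

noncomputable section

open Filter Set Topology MeasureTheory Metric Function
open scoped ENNReal NNReal
open Literature.Analysis.FluidPDE

namespace Summit.NavierStokesRegularity.NavierStokesRegularity.Theorems

/-- **The scaled `L²`-defect floor for the blow-up rescalings of a Landau-tailed solution** (registered support
stub A7 of crux stmt-NavierStokesRegularity-1944, lead c6): with `c = c(U) > 0` from
`landauTail_defect_floor_engine`, every classical unit-viscosity `(u, p)` on `ℝ³ × (−1,0)` with the tail
`√(−t) u(t, √(−t) y) → U y` (`y ≠ 0`) has `liminf_{r→0⁺} ∫_{s₁}^{s₂}∫_{B_ρ} |nsRescale r u − U|² ≥ c ρ (s₂ − s₁)`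
for all `ρ ∈ (0,1]`, `−1 ≤ s₁ < s₂ ≤ 0` (Landau 1944; Lemarié-Rieusset 2016 (10.48); Chae 2007 p. 8). -/
theorem landauTail_defect_floor : ∀ (U : EuclideanSpace ℝ (Fin 3) → EuclideanSpace ℝ (Fin 3)) (P : EuclideanSpace ℝ (Fin 3) → ℝ), (ContDiffOn ℝ (⊤ : ℕ∞) U {0}ᶜ ∧ ContDiffOn ℝ (⊤ : ℕ∞) P {0}ᶜ ∧ (∀ x : EuclideanSpace ℝ (Fin 3), x ≠ 0 → Literature.Analysis.FluidPDE.convect U U x + gradient P x = (1 : ℝ) • Laplacian.laplacian U x) ∧ (∀ x : EuclideanSpace ℝ (Fin 3), x ≠ 0 → Literature.Analysis.FluidPDE.VectorCalculus.divergence U x = 0) ∧ (∀ c : ℝ, 0 < c → ∀ x : EuclideanSpace ℝ (Fin 3), U (c • x) = c⁻¹ • U x) ∧ (∃ x : EuclideanSpace ℝ (Fin 3), U x ≠ 0)) → ∃ c : ℝ, 0 < c ∧ ∀ (u : ℝ → EuclideanSpace ℝ (Fin 3) → EuclideanSpace ℝ (Fin 3)) (p : ℝ → EuclideanSpace ℝ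 (Fin 3) → ℝ), Literature.Analysis.FluidPDE.IsClassicalNSSolutionOn (Set.Ioo (-1) 0) 1 0 u p → (∀ y : EuclideanSpace ℝ (Fin 3), y ≠ 0 → Filter.Tendsto (fun t : ℝ => Real.sqrt (0 - t) • u t (Real.sqrt (0 - t) • y)) (nhdsWithin 0 (Set.Iio 0)) (nhds (U y))) → ∀ ρ : ℝ, 0 < ρ → ρ ≤ 1 → ∀ s₁ s₂ : ℝ, -1 ≤ s₁ → s₁ < s₂ → s₂ ≤ 0 → ENNReal.ofReal (c * ρ * (s₂ - s₁)) ≤ Filter.liminf (fun r : ℝ => ∫⁻ z in Set.Ioo s₁ s₂ ×ˢ Metric.ball (0 : EuclideanSpace ℝ (Fin 3)) ρ, ‖Literature.Analysis.FluidPDE.nsRescale r u z.1 z.2 - U z.2‖ₑ ^ 2) (nhdsWithin 0 (Set.Ioi 0)) := by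
  intro U P hprof
  obtain ⟨c, hc, hA6⟩ := landauTail_defect_floor_engine U P hprof
  obtain ⟨-, -, -, -, hhom, -⟩ := hprof
  refine ⟨c, hc, ?_⟩
  intro u p hcl htail ρ hρ hρ1 s₁ s₂ hs₁ hs₁₂ hs₂
  set S : Set (ℝ × EuclideanSpace ℝ (Fin 3)) := Ioo s₁ s₂ ×ˢ ball (0 : EuclideanSpace ℝ (Fin 3)) ρ with hSdef
  set G : ℝ → ℝ≥0∞ := fun r => ∫⁻ z in S, ‖nsRescale r u z.1 z.2 - U z.2‖ₑ ^ 2 with hG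
  show ENNReal.ofReal (c * ρ * (s₂ - s₁)) ≤ liminf G (𝓝[>] (0 : ℝ))
  by_contra hcon
  rw [not_le] at hcon
  -- a level strictly between the `liminf` and the floor, undershot along a sequence `r_n → 0⁺` in `(0, 1)`
  obtain ⟨b', hb'1, hb'2⟩ := exists_between hcon
  have hfreq : ∃ᶠ r in 𝓝[>] (0 : ℝ), G r < b' := frequently_lt_of_liminf_lt (by isBoundedDefault) hb'1
  obtain ⟨rs, hrs, hrs'⟩ := exists_seq_forall_of_frequently
    (hfreq.and_eventually (Ioo_mem_nhdsGT zero_lt_one : Set.Ioo (0 : ℝ) 1 ∈ 𝓝[>] (0 : ℝ)))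
  -- the rescalings are classical solutions on `(-1, 0)` converging pointwise off the axis to `U`
  set w : ℕ → ℝ → EuclideanSpace ℝ (Fin 3) → EuclideanSpace ℝ (Fin 3) := fun n => nsRescale (rs n) u
    with hw_def
  have hwcl : ∀ n, IsClassicalNSSolutionOn (Ioo (-1) 0) 1 0 (w n) (nsRescalePressure (rs n) p) := by
    intro n
    obtain ⟨hr0, hr1⟩ := (hrs' n).2
    have key := IsClassicalNSSolutionOn.nsRescale_holds hcl hr0
    rw [nsRescaleForce_zero] at key
    refine key.mono (fun t ht => ?_) (uniqueDiffOn_Ioo (-1) 0)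
    simp only [mem_preimage, mem_Ioo] at ht ⊢
    have hr2 : (rs n) ^ 2 ≤ 1 := pow_le_one₀ hr0.le hr1.le
    refine ⟨?_, mul_neg_of_pos_of_neg (pow_pos hr0 2) ht.2⟩
    nlinarith [mul_nonneg (sub_nonneg.2 hr2) (neg_nonneg.2 ht.2.le)]
  have hptw : ∀ τ ∈ Ioo (-1 : ℝ) 0, ∀ y : EuclideanSpace ℝ (Fin 3), y ≠ 0 →
      Tendsto (fun n => w n τ y) atTop (𝓝 (U y)) := fun τ hτ y hy =>
    (landauTail_nsRescale_tendsto_profile u U hhom htail τ hτ.2 y hy).comp hrs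
  -- the engine bounds the `liminf` along the sequence from below; the level `b'` bounds it from above
  have h1 := hA6 w (fun n => nsRescalePressure (rs n) p) hwcl hptw ρ hρ hρ1 s₁ s₂ hs₁ hs₁₂ hs₂
  have h2 : liminf (fun n => ∫⁻ z in Ioo s₁ s₂ ×ˢ ball (0 : EuclideanSpace ℝ (Fin 3)) ρ,
      ‖w n z.1 z.2 - U z.2‖ₑ ^ 2) atTop ≤ b' :=
    liminf_le_of_frequently_le' (Eventually.of_forall fun n => (hrs' n).1.le).frequently
  exact absurd (h1.trans h2) (not_le.2 hb'2)

end Summit.NavierStokesRegularity.NavierStokesRegularity.Theorems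

end
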